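import Summits.HodgeConjecture.HodgeConjecture.Cruxes.BlochSeedDiscOne.DepthBoundA4

/-!
# DeepestCover — a charged N-slot is covered only from two co-levels deeper; apex P-letters cover only the hub;
# the cover table of the deepest class `(3,3)` over the XBASE N-letters (plan-lens-HodgeAV-extremal g10, memo `VERTEX-STRUCTURE-extremal-g10.md` §2)

Token: line stmt-HodgeConjecture-18881 Cruxes/BlochSeedDiscOne/Lines/birth.lean 814a6a70c14e831a stub_rung_pad4_seedAt.

EVIDENCE-LEVEL TYPED FILE about the letter model of `DepthBoundA4.lean` (every height `h`); NOT a rung; nothing here is proved toward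
HC ∕ HC_CM ∕ HC_AV ∕ №4 ∕ 26512 ∕ 18881 ∕ H2 (letters ≠ sheaves ≠ a SEED).  It records the (A4)-side input of memo-10's DEEPEST-CELL
ORIENTATION MECHANISM:
 * `eq_hub_of_colevel_zero`, `apex_covers_only_hub` — on one height, an ample cover from a co-level-2 letter (an apex P-letter `(h−2; ±1, ±1)`)
   reaches only the hub; more generally `charged_slot_needs_deeper_cover`: along a live arrow `x → y`, every non-hub slot of `y` sits two
   co-levels above the corresponding slot of `x` (this is `colevel_drop_two` of the tree, restated slotwise at design level);
 * `A4_allCharged_cover_deepest` — in an (A4) design on a TWO-CLASS P-alphabet (every P-letter has co-level 2 or co-level `c`), every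
   supported N-cell with no hub letter is live below a supported P-cell all of whose letters have co-level `c` (a «deepest cell»);
 * `cover_of_b_needs_three` + the `t₀ = (h−5;3,2)` entries — thin classes cover `z(2,0)`, `k(2,1)` only, never a `b`-letter (memo-10 §4.3);
 * the sixteen-entry COVER TABLE of the deepest XBASE letter `m₀ = (h−6; 3, 3)` against the charged XBASE N-letters
   `(h−2; ±2,0),(h−2; 0,±2)` (z), `(h−3; ±2,±1),(h−3; ±1,±2)` (k), `(h−4; ±2,±2)` (b): `m₀` is amply below exactly the five first-quadrant letters
   `(h−2;2,0), (h−2;0,2), (h−3;2,1), (h−3;1,2), (h−4;2,2)` (memo-10 §2.1; the other three quadrants by the slotwise rotation symmetry).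
Consequence used in memo-10 (proved there by exact LP certificates, not here): if all deepest P-cells of a design share one quadrant vector, all
its hub-free N-cells are slotwise confined to these five letters, and then μ vanishes identically (`data/cert_ustar_d33.json`).

0 `sorry`; tactics `omega` ∕ `nlinarith` ∕ `norm_num` ∕ `simp`; no `decide` ∕ `native_decide`; no axiom ∕ instance ∕ notation; no unsafe options.
-/

set_option linter.dupNamespace false
set_option autoImplicit false

namespace Summit.HodgeConjecture.HodgeConjecture.Cruxes.BlochSeedDiscOne.DepthBoundA4

section deepestcover

/-- Co-level is non-negative. -/
theorem colevel_nonneg (ℓ : Letter) : 0 ≤ ℓ.colevel := by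
  unfold Letter.colevel; positivity

/-- On the height-`h` alphabet the only letter of co-level `0` is the hub `(h; 0, 0)`. -/
theorem eq_hub_of_colevel_zero {h : ℤ} (ℓ : Letter) (hℓ : ℓ.OnAlphabet h) (h0 : ℓ.colevel = 0) :
    ℓ = Letter.hub h := by
  obtain ⟨a, x, y⟩ := ℓ
  simp only [Letter.OnAlphabet, Letter.height, Letter.colevel] at hℓ h0
  obtain ⟨hh, _⟩ := hℓ
  have hax := abs_nonneg x
  have hay := abs_nonneg y
  have hx0 : |x| = 0 := by omega
  have hy0 : |y| = 0 := by omega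
  have hx : x = 0 := abs_eq_zero.mp hx0
  have hy : y = 0 := abs_eq_zero.mp hy0
  subst hx; subst hy
  have ha : a = h := by simpa using hh
  subst ha
  rfl

/-- **APEX COVERS ONLY THE HUB.** On one height, a letter of co-level `2` (an apex P-letter `(h−2; ±1, ±1)`, or `(h−2; ±2, 0)` …) is amply
below `ℓ'` only if `ℓ'` is the hub. -/
theorem apex_covers_only_hub {h : ℤ} (ℓ ℓ' : Letter) (hℓ : ℓ.OnAlphabet h) (hℓ' : ℓ'.OnAlphabet h)
    (h2 : ℓ.colevel = 2) (hA : AmpleAbove ℓ ℓ') : ℓ' = Letter.hub h := by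
  have hd := colevel_drop_two ℓ ℓ' (hℓ.1.trans hℓ'.1.symm) hA
  have hn := colevel_nonneg ℓ'
  exact eq_hub_of_colevel_zero ℓ' hℓ' (by omega)

/-- **A CHARGED SLOT IS COVERED ONLY FROM TWO CO-LEVELS DEEPER** (design level, every height): along a live arrow `x → y` of an (A4) design,
`colevel (y f) + 2 ≤ colevel (x f)` on every factor; in particular a non-hub slot of `y` is never covered by an apex letter. -/
theorem charged_slot_needs_deeper_cover {h : ℤ} {D : Design} (hD : D.OnAlphabet h) :
    ∀ x ∈ D.suppP, ∀ y ∈ D.suppN, Live x y → ∀ f : Fin 4, (y f).colevel + 2 ≤ (x f).colevel := by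
  intro x hx y hy hlive f
  have hxA : (x f).OnAlphabet h := hD x (List.mem_append.mpr (Or.inr hx)) f
  have hyA : (y f).OnAlphabet h := hD y (List.mem_append.mpr (Or.inl hy)) f
  exact colevel_drop_two (x f) (y f) (hxA.1.trans hyA.1.symm) (hlive f)

/-- **HUB-FREE N-CELLS ARE COVERED BY DEEPEST CELLS.** In an (A4) design on the height-`h` alphabet whose P-letters all have co-level `2` or
co-level `c` (a two-class P-alphabet `P{apex, d}` as in memo-09∕10's family), every supported N-cell without a hub letter is live below a
supported P-cell all four of whose letters have co-level `c`. -/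
theorem A4_hubFree_cover_deepest {h c : ℤ} {D : Design} (hD : D.OnAlphabet h) (h4 : D.A4)
    (hP : ∀ x ∈ D.suppP, ∀ f : Fin 4, (x f).colevel = 2 ∨ (x f).colevel = c) :
    ∀ y ∈ D.suppN, (∀ f : Fin 4, y f ≠ Letter.hub h) →
      ∃ x ∈ D.suppP, Live x y ∧ ∀ f : Fin 4, (x f).colevel = c := by
  intro y hy hcharged
  obtain ⟨x, hx, hlive⟩ := h4.2 y hy
  refine ⟨x, hx, hlive, fun f => ?_⟩
  rcases hP x hx f with h2 | hc
  · exfalso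
    have hxA : (x f).OnAlphabet h := hD x (List.mem_append.mpr (Or.inr hx)) f
    have hyA : (y f).OnAlphabet h := hD y (List.mem_append.mpr (Or.inl hy)) f
    exact hcharged f (apex_covers_only_hub (x f) (y f) hxA hyA h2 (hlive f))
  · exact hc

/-- Unfolding `AmpleAbove` on explicit letters. -/
theorem ampleAbove_mk_iff (a x y a' x' y' : ℤ) :
    AmpleAbove ⟨a, x, y⟩ ⟨a', x', y'⟩ ↔ a < a' ∧ (x' - x) ^ 2 + (y' - y) ^ 2 < (a' - a) ^ 2 := Iff.rfl

/-! ### The cover table of `m₀ = (h−6; 3, 3)` against the sixteen charged XBASE N-letters (memo-10 §2.1) -/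

/-- `m₀` covers the z-letter `(h−2; 2, 0)`. -/
theorem m0_covers_z20 (h : ℤ) : AmpleAbove ⟨h - 6, 3, 3⟩ ⟨h - 2, 2, 0⟩ := by
  rw [ampleAbove_mk_iff]; constructor
  · omega
  · nlinarith
/-- `m₀` covers the z-letter `(h−2; 0, 2)`. -/
theorem m0_covers_z02 (h : ℤ) : AmpleAbove ⟨h - 6, 3, 3⟩ ⟨h - 2, 0, 2⟩ := by
  rw [ampleAbove_mk_iff]; constructor
  · omega
  · nlinarith
/-- `m₀` covers the k-letter `(h−3; 2, 1)`. -/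
theorem m0_covers_k21 (h : ℤ) : AmpleAbove ⟨h - 6, 3, 3⟩ ⟨h - 3, 2, 1⟩ := by
  rw [ampleAbove_mk_iff]; constructor
  · omega
  · nlinarith
/-- `m₀` covers the k-letter `(h−3; 1, 2)`. -/
theorem m0_covers_k12 (h : ℤ) : AmpleAbove ⟨h - 6, 3, 3⟩ ⟨h - 3, 1, 2⟩ := by
  rw [ampleAbove_mk_iff]; constructor
  · omega
  · nlinarith
/-- `m₀` covers the b-letter `(h−4; 2, 2)`. -/
theorem m0_covers_b22 (h : ℤ) : AmpleAbove ⟨h - 6, 3, 3⟩ ⟨h - 4, 2, 2⟩ := by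
  rw [ampleAbove_mk_iff]; constructor
  · omega
  · nlinarith

/-- `m₀` does NOT cover the other two z-letters … -/
theorem m0_not_covers_zm20 (h : ℤ) : ¬ AmpleAbove ⟨h - 6, 3, 3⟩ ⟨h - 2, -2, 0⟩ := by
  rw [ampleAbove_mk_iff]; rintro ⟨_, h2⟩; nlinarith
theorem m0_not_covers_z0m2 (h : ℤ) : ¬ AmpleAbove ⟨h - 6, 3, 3⟩ ⟨h - 2, 0, -2⟩ := by
  rw [ampleAbove_mk_iff]; rintro ⟨_, h2⟩; nlinarith
/-- … nor the six k-letters outside the open first quadrant … -/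
theorem m0_not_covers_km21 (h : ℤ) : ¬ AmpleAbove ⟨h - 6, 3, 3⟩ ⟨h - 3, -2, 1⟩ := by
  rw [ampleAbove_mk_iff]; rintro ⟨_, h2⟩; nlinarith
theorem m0_not_covers_km12 (h : ℤ) : ¬ AmpleAbove ⟨h - 6, 3, 3⟩ ⟨h - 3, -1, 2⟩ := by
  rw [ampleAbove_mk_iff]; rintro ⟨_, h2⟩; nlinarith
theorem m0_not_covers_km2m1 (h : ℤ) : ¬ AmpleAbove ⟨h - 6, 3, 3⟩ ⟨h - 3, -2, -1⟩ := by
  rw [ampleAbove_mk_iff]; rintro ⟨_, h2⟩; nlinarith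
theorem m0_not_covers_km1m2 (h : ℤ) : ¬ AmpleAbove ⟨h - 6, 3, 3⟩ ⟨h - 3, -1, -2⟩ := by
  rw [ampleAbove_mk_iff]; rintro ⟨_, h2⟩; nlinarith
theorem m0_not_covers_k1m2 (h : ℤ) : ¬ AmpleAbove ⟨h - 6, 3, 3⟩ ⟨h - 3, 1, -2⟩ := by
  rw [ampleAbove_mk_iff]; rintro ⟨_, h2⟩; nlinarith
theorem m0_not_covers_k2m1 (h : ℤ) : ¬ AmpleAbove ⟨h - 6, 3, 3⟩ ⟨h - 3, 2, -1⟩ := by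
  rw [ampleAbove_mk_iff]; rintro ⟨_, h2⟩; nlinarith
/-- … nor the three other b-letters. -/
theorem m0_not_covers_bm22 (h : ℤ) : ¬ AmpleAbove ⟨h - 6, 3, 3⟩ ⟨h - 4, -2, 2⟩ := by
  rw [ampleAbove_mk_iff]; rintro ⟨_, h2⟩; nlinarith
theorem m0_not_covers_bm2m2 (h : ℤ) : ¬ AmpleAbove ⟨h - 6, 3, 3⟩ ⟨h - 4, -2, -2⟩ := by
  rw [ampleAbove_mk_iff]; rintro ⟨_, h2⟩; nlinarith
theorem m0_not_covers_b2m2 (h : ℤ) : ¬ AmpleAbove ⟨h - 6, 3, 3⟩ ⟨h - 4, 2, -2⟩ := by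
  rw [ampleAbove_mk_iff]; rintro ⟨_, h2⟩; nlinarith

/-- `m₀` also covers the hub, and no apex letter `(h−2; ±1, ±1)` (same height as z: `a`-difference would have to be positive). -/
theorem m0_covers_hub (h : ℤ) : AmpleAbove ⟨h - 6, 3, 3⟩ (Letter.hub h) := by
  show AmpleAbove ⟨h - 6, 3, 3⟩ ⟨h, 0, 0⟩
  rw [ampleAbove_mk_iff]; constructor
  · omega
  · nlinarith

/-- The apex letter `a₀ = (h−2; 1, 1)` covers the hub and none of the sixteen charged XBASE letters (an instance of `apex_covers_only_hub`;
two table entries spelled out). -/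
theorem a0_covers_hub (h : ℤ) : AmpleAbove ⟨h - 2, 1, 1⟩ (Letter.hub h) := by
  show AmpleAbove ⟨h - 2, 1, 1⟩ ⟨h, 0, 0⟩
  rw [ampleAbove_mk_iff]; constructor
  · omega
  · nlinarith
theorem a0_not_covers_z20 (h : ℤ) : ¬ AmpleAbove ⟨h - 2, 1, 1⟩ ⟨h - 2, 2, 0⟩ := by
  rw [ampleAbove_mk_iff]; rintro ⟨h1, _⟩; omega
theorem a0_not_covers_k21 (h : ℤ) : ¬ AmpleAbove ⟨h - 2, 1, 1⟩ ⟨h - 3, 2, 1⟩ := by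
  rw [ampleAbove_mk_iff]; rintro ⟨h1, _⟩; omega

/-! ### Thin covering classes (memo-10 §4.3): `t₀ = (h−5; 3, 2)` covers exactly `z(2,0)` and `k(2,1)` among the first-quadrant charged letters,
and a `b`-letter `(·; ±2, ±2)` is covered only from letters with `|x| ≥ 3` and `|y| ≥ 3` (immediate from the tree's `strict_shrink`). -/

/-- A cover of a letter with `|x'| = 2`, `|y'| = 2` has `|x| ≥ 3` and `|y| ≥ 3` (so thin classes `(u,1)`, `(u,2)` never cover a `b`-letter). -/
theorem cover_of_b_needs_three (ℓ ℓ' : Letter) (hh : ℓ.height = ℓ'.height) (hA : AmpleAbove ℓ ℓ')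
    (hx : |ℓ'.x| = 2) (hy : |ℓ'.y| = 2) : 3 ≤ |ℓ.x| ∧ 3 ≤ |ℓ.y| := by
  obtain ⟨h1, h2⟩ := strict_shrink ℓ ℓ' hh hA
  constructor <;> omega

theorem t0_covers_z20 (h : ℤ) : AmpleAbove ⟨h - 5, 3, 2⟩ ⟨h - 2, 2, 0⟩ := by
  rw [ampleAbove_mk_iff]; constructor
  · omega
  · nlinarith
theorem t0_covers_k21 (h : ℤ) : AmpleAbove ⟨h - 5, 3, 2⟩ ⟨h - 3, 2, 1⟩ := by
  rw [ampleAbove_mk_iff]; constructor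
  · omega
  · nlinarith
theorem t0_not_covers_z02 (h : ℤ) : ¬ AmpleAbove ⟨h - 5, 3, 2⟩ ⟨h - 2, 0, 2⟩ := by
  rw [ampleAbove_mk_iff]; rintro ⟨_, h2⟩; nlinarith
theorem t0_not_covers_k12 (h : ℤ) : ¬ AmpleAbove ⟨h - 5, 3, 2⟩ ⟨h - 3, 1, 2⟩ := by
  rw [ampleAbove_mk_iff]; rintro ⟨_, h2⟩; nlinarith
theorem t0_not_covers_b22 (h : ℤ) : ¬ AmpleAbove ⟨h - 5, 3, 2⟩ ⟨h - 4, 2, 2⟩ := by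
  rw [ampleAbove_mk_iff]; rintro ⟨_, h2⟩; nlinarith
theorem t0_covers_hub (h : ℤ) : AmpleAbove ⟨h - 5, 3, 2⟩ (Letter.hub h) := by
  show AmpleAbove ⟨h - 5, 3, 2⟩ ⟨h, 0, 0⟩
  rw [ampleAbove_mk_iff]; constructor
  · omega
  · nlinarith

end deepestcover

end Summit.HodgeConjecture.HodgeConjecture.Cruxes.BlochSeedDiscOne.DepthBoundA4
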